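import Mathlib.Algebra.MvPolynomial.PDeriv
import Mathlib.RingTheory.MvPolynomial.Basic
import Mathlib.RingTheory.Algebraic.Basic
import Mathlib.Analysis.SpecialFunctions.Pow.Real
import Mathlib.Analysis.Complex.Basic
import Mathlib.Order.Filter.AtTopBot.Basic
import Literature.NumberTheory.Transcendental.RoyCriterion
import HarnessLib

/-!
# Small value estimates on `𝔾ₐ × 𝔾ₘ` (Roy 2013; Nguyen–Roy 2016) — two named facts

Topic `Literature/NumberTheory/Transcendental`. Two NAMED FACTS (D-0014), the PRINTED theorems behind
the method-level cruxes `Summit.Schanuel.Schanuel.Theses.RoyCriterion.RoySmallValueDirichletGap`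
(item `stmt-Schanuel-1050`) and `Summit.Schanuel.Schanuel.Theses.RoyCriterion.NguyenRoySmallValueTranslates`
(item `stmt-Schanuel-1051`). Both route items are the same statements with the lower bound on `ν`
pushed DOWN to the Dirichlet exponent `2 + β − τ` (resp. `2 + β − σ` on the whole range
`1 ≤ σ < 2`), which is OPEN; the facts below record exactly what is proved in print, in the same
Lean shape as the items (Roy's derivation `royD = ∂/∂X₀ + X₁ ∂/∂X₁` and the naive height
`mvPolyHeight` of `Literature/NumberTheory/Transcendental/RoyCriterion.lean`; "norm `‖P‖` = largest
absolute value of the coefficients" in both papers), so that each item is `fact ∧ (gap case)`.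

## What the sources print (verified on the arXiv texts, 2026-08-15)

* Roy 2013 (Mathematika 59, 333–363 = arXiv:1301.0663), Theorem 1.1 (p. 2 of the arXiv text):
  "Let `(ξ,η) ∈ 𝒢 = ℂ × ℂˣ`, and let `β, τ, ν ∈ ℝ` with `1 ≤ τ < 2`, `β > τ` and
  `ν > 2 + β − τ + (τ−1)(2−τ)/(β+1−τ)`. Suppose that, for each sufficiently large positive integer
  `D`, there exists a non-zero polynomial `P_D ∈ ℤ[X₁,X₂]` of degree `≤ D` and norm `≤ exp(D^β)`
  such that `max_{0 ≤ i < 3⌊D^τ⌋} |𝒟₁^i P_D(ξ,η)| ≤ exp(−D^ν)`. Then, we have `ξ, η ∈ ℚ̄` and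
  moreover `𝒟₁^i P_D(ξ,η) = 0` (`0 ≤ i < 3⌊D^τ⌋`) for each sufficiently large integer `D`."
  Here `𝒟₁ = ∂/∂X₁ + X₂ ∂/∂X₂`. The "moreover" clause follows from the first by Liouville's
  inequality (ibid., next paragraph) and is not rendered. Dirichlet remark (ibid. p. 3): for
  `ν < 2 + β − τ` such `P_D` exist at EVERY point, so the bound on `ν` "could not be [reduced] by
  more than `(τ−1)(2−τ)/(β+1−τ) ≤ (τ−1)(2−τ) ≤ 1/4`".
* Nguyen–Roy 2016 (Int. J. Number Theory 12, 1273–1293 = arXiv:1412.5163), Theorem 1 (pp. 1–2):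
  "(1) `(ξ,η) ∈ ℂ × ℂˣ` and `(r,s) ∈ ℚ × ℚˣ` with `r ≠ 0` and `s ≠ ±1`. … Let `σ, β, ν ∈ ℝ`
  satisfying `1 ≤ σ < 2`, `β > σ + 1`, `ν > 2 + β − σ` if `σ ≥ 3/2`,
  `ν > 2 + β − σ + (σ−1)(3−2σ)/(2+β−2σ)` if `σ < 3/2`. Suppose that, for each sufficiently large
  positive integer `D`, there exists a non-zero polynomial `P_D ∈ ℤ[X₁,X₂]` such that `deg P_D ≤ D`,
  `‖P_D‖ ≤ e^{D^β}`, `max_{0 ≤ i < 4⌊D^σ⌋} |P_D(ξ + ir, η s^i)| ≤ e^{−D^ν}`. Then, `ξ` and `η` are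
  algebraic over `ℚ`. Moreover, we have `P_D(ξ + ir, η s^i) = 0` (`0 ≤ i < 4⌊D^σ⌋`) for each
  sufficiently large `D`." Best-possible remark p. 2: for `σ ≥ 3/2` the constraint on `ν` is best
  possible (Dirichlet); closing question p. 3: "It would be interesting to know if the constraint on
  `ν` in our main theorem could be improved to `ν > 2+β−σ` for any value of `σ` in the range
  `1 ≤ σ < 2`."

Rendering: "degree" = `MvPolynomial.totalDegree`; "norm" = `mvPolyHeight` (max of `|coeff|`);
"for each sufficiently large `D` there exists" = `∀ᶠ D in atTop, ∃ …`; `𝒟₁^i P` = `royD^[i] P`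
(indices `0, 1 : Fin 2` stand for the printed `X₁, X₂`); `|·|` on `ℂ` = `‖·‖`; the point
`(ξ + ir, η s^i)` is evaluated with `MvPolynomial.aeval ![ξ + i·r, η·s^i]`. Users take
`(h : roy2013_thm_1_1)` / `(h : nguyenRoy2016_thm_1)`.

## References

* [Roy2013] D. Roy, *A small value estimate for 𝔾ₐ × 𝔾ₘ*, Mathematika 59 (2013), 333–363
  (arXiv:1301.0663), Theorem 1.1 and the two paragraphs after it.
* [NguyenRoy2016] N. A. V. Nguyen, D. Roy, *A small value estimate in dimension two involving
  translations by rational points*, Int. J. Number Theory 12 (2016), 1273–1293 (arXiv:1412.5163),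
  eq. (1), Theorem 1, and the closing question of §1.
* [Roy2001] D. Roy, *An arithmetic criterion for the values of the exponential function*,
  Acta Arith. 97 (2001), 183–194, §1 (the derivation `D`, the height) — via `RoyCriterion.lean`.
-/

noncomputable section

open MvPolynomial Filter

namespace Literature.NumberTheory.Transcendental

/-- **Roy's small value estimate for `𝔾ₐ × 𝔾ₘ` at one point** (Roy 2013, Theorem 1.1, main
conclusion): let `(ξ, η) ∈ ℂ × ℂˣ` and `β, τ, ν ∈ ℝ` with `1 ≤ τ < 2`, `β > τ`,
`ν > 2 + β − τ + (τ−1)(2−τ)/(β+1−τ)`; if for each sufficiently large `D` there is a non-zero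
`P_D ∈ ℤ[X₁, X₂]` of total degree `≤ D` and height `≤ exp(D^β)` with
`|𝒟₁^i P_D(ξ, η)| ≤ exp(−D^ν)` for `0 ≤ i < 3⌊D^τ⌋` (`𝒟₁ = ∂/∂X₁ + X₂∂/∂X₂ = royD`), then `ξ`
and `η` are algebraic over `ℚ`. The printed "moreover" clause (the derivatives then vanish for
large `D`, by Liouville) is omitted. Grounds `Summit.Schanuel.Schanuel.Theses.RoyCriterion.RoySmallValueDirichletGap`
(item stmt-Schanuel-1050), which is this statement with the weaker hypothesis `ν > 2 + β − τ`
(the Dirichlet edge; open for `1 < τ < 2`, identical at `τ = 1`). Named fact (D-0014); users take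
`(h : roy2013_thm_1_1)`. [cite: Roy2013, Theorem 1.1] -/
def roy2013_thm_1_1 : Prop :=
  ∀ (ξ η : ℂ), η ≠ 0 → ∀ (β τ ν : ℝ), 1 ≤ τ → τ < 2 → τ < β →
    2 + β - τ + (τ - 1) * (2 - τ) / (β + 1 - τ) < ν →
    (∀ᶠ D : ℕ in atTop, ∃ P : MvPolynomial (Fin 2) ℤ, P ≠ 0 ∧ P.totalDegree ≤ D ∧
      (mvPolyHeight P : ℝ) ≤ Real.exp ((D : ℝ) ^ β) ∧
      ∀ i : ℕ, i < 3 * ⌊(D : ℝ) ^ τ⌋₊ →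
        ‖aeval ![ξ, η] (royD^[i] P)‖ ≤ Real.exp (-(D : ℝ) ^ ν)) →
    IsAlgebraic ℚ ξ ∧ IsAlgebraic ℚ η

/-- **Nguyen–Roy's small value estimate at rational translates** (Nguyen–Roy 2016, Theorem 1,
main conclusion): let `(ξ, η) ∈ ℂ × ℂˣ`, `(r, s) ∈ ℚ × ℚˣ` with `r ≠ 0`, `s ≠ ±1`, and
`σ, β, ν ∈ ℝ` with `1 ≤ σ < 2`, `β > σ + 1`, and `ν > 2 + β − σ` if `σ ≥ 3/2`,
`ν > 2 + β − σ + (σ−1)(3−2σ)/(2+β−2σ)` if `σ < 3/2`; if for each sufficiently large `D` there is a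
non-zero `P_D ∈ ℤ[X₁, X₂]` with `deg P_D ≤ D`, `‖P_D‖ ≤ e^{D^β}` and
`|P_D(ξ + ir, η s^i)| ≤ e^{−D^ν}` for `0 ≤ i < 4⌊D^σ⌋`, then `ξ` and `η` are algebraic over `ℚ`.
The printed "moreover" clause (the values then vanish for large `D`) is omitted. Grounds
`Summit.Schanuel.Schanuel.Theses.RoyCriterion.NguyenRoySmallValueTranslates` (item
stmt-Schanuel-1051), which asks for `ν > 2 + β − σ` on the whole range `1 ≤ σ < 2` (the authors'
closing question; open for `1 < σ < 3/2`, identical for `σ ≥ 3/2` and at `σ = 1`). Named fact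
(D-0014); users take `(h : nguyenRoy2016_thm_1)`. [cite: NguyenRoy2016, Theorem 1] -/
def nguyenRoy2016_thm_1 : Prop :=
  ∀ (ξ η : ℂ), η ≠ 0 → ∀ (r s : ℚ), r ≠ 0 → s ≠ 0 → s ≠ 1 → s ≠ -1 →
    ∀ (σ β ν : ℝ), 1 ≤ σ → σ < 2 → σ + 1 < β →
    (3 / 2 ≤ σ → 2 + β - σ < ν) →
    (σ < 3 / 2 → 2 + β - σ + (σ - 1) * (3 - 2 * σ) / (2 + β - 2 * σ) < ν) →
    (∀ᶠ D : ℕ in atTop, ∃ P : MvPolynomial (Fin 2) ℤ, P ≠ 0 ∧ P.totalDegree ≤ D ∧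
      (mvPolyHeight P : ℝ) ≤ Real.exp ((D : ℝ) ^ β) ∧
      ∀ i : ℕ, i < 4 * ⌊(D : ℝ) ^ σ⌋₊ →
        ‖aeval ![ξ + (i : ℂ) * (r : ℂ), η * (s : ℂ) ^ i] P‖ ≤ Real.exp (-(D : ℝ) ^ ν)) →
    IsAlgebraic ℚ ξ ∧ IsAlgebraic ℚ η

/-- The two printed constraints on `ν` in Nguyen–Roy's Theorem 1 are both implied by the single
gap-free bound `ν > 2 + β − σ + max(0, (σ−1)(3−2σ)/(2+β−2σ))`-type hypothesis used when
specialising: for `σ ≥ 3/2` only the first clause fires, for `σ < 3/2` only the second; in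
particular at `σ = 1` the correction term vanishes, so the fact yields the route item's `σ = 1`
case verbatim. Recorded as the arithmetic identity `(1 − 1)(3 − 2·1) = 0`. [folklore] -/
theorem nguyenRoy_correction_vanishes_at_one (β : ℝ) :
    (2 : ℝ) + β - 1 + (1 - 1) * (3 - 2 * 1) / (2 + β - 2 * 1) = 2 + β - 1 := by
  ring

/-- Likewise Roy's correction term `(τ−1)(2−τ)/(β+1−τ)` vanishes at `τ = 1`, so
`roy2013_thm_1_1` yields the `τ = 1` case of the route item `RoySmallValueDirichletGap`
verbatim; the open content is `1 < τ < 2`. [folklore] -/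
theorem roy_correction_vanishes_at_one (β : ℝ) :
    (2 : ℝ) + β - 1 + (1 - 1) * (2 - 1) / (β + 1 - 1) = 2 + β - 1 := by
  ring

/-- **The `τ = 1` case of the Dirichlet-edge statement is Roy's theorem**: from `roy2013_thm_1_1`,
for `τ = 1` the hypothesis `ν > 2 + β − 1` already suffices (the printed correction term is `0`).
[cite: Roy2013, Theorem 1.1] -/
theorem roy2013_thm_1_1.tau_one (h : roy2013_thm_1_1) (ξ η : ℂ) (hη : η ≠ 0) (β ν : ℝ)
    (hβ : 1 < β) (hν : 2 + β - 1 < ν)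
    (hP : ∀ᶠ D : ℕ in atTop, ∃ P : MvPolynomial (Fin 2) ℤ, P ≠ 0 ∧ P.totalDegree ≤ D ∧
      (mvPolyHeight P : ℝ) ≤ Real.exp ((D : ℝ) ^ β) ∧
      ∀ i : ℕ, i < 3 * ⌊(D : ℝ) ^ (1 : ℝ)⌋₊ →
        ‖aeval ![ξ, η] (royD^[i] P)‖ ≤ Real.exp (-(D : ℝ) ^ ν)) :
    IsAlgebraic ℚ ξ ∧ IsAlgebraic ℚ η :=
  h ξ η hη β 1 ν le_rfl (by norm_num) hβ (by simpa using hν) hP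

end Literature.NumberTheory.Transcendental

end
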